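import Summits.Ventures.CertifiedManyBodySolver.Certificates.HubbardSquare_tpm3o10_U29o5_toyKernelCert_bondRow
import Summits.Ventures.CertifiedManyBodySolver.Rows.CorrWindowCertKernelChainQuotCloser
import HarnessLib

/-!
# STEP-0 of the HINTED SYMMETRY-QUOTIENT replay: the `↓`-spin bond row at the La214-E station `(1, −3/10, 29/5)` — value `−7/8`,
# slope `−1` at `n₀ = 7/8` — from a certificate solved in ORBIT coordinates (`n_{e₁↓} ≡ n_{0↓}` under translation), replayed over RAW
# words by a 3-step hinted merge chain whose ONE symmetry identification arrives as an UNTRUSTED HINT checked by the kernel — ZERO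
# hypotheses, NO symmetry data in the instance

HONEST FRAMING: a TOY (the bond bound `|⟨c†_0 c_{e₁}+h.c.⟩| ≤ 2⟨n⟩`-type inequality is textbook) and a TEMPLATE for the exporter: the
certificate `(a_{0↓}+a_{e₁↓})†(a_{0↓}+a_{e₁↓}) ⪰ 0` with density multiplier `μ_↓ = −2` closes only modulo the translation
identification `ω(n_{e₁↓}) = ω(n_{0↓})`; here the residual is sliced WITHOUT any symmetry family (`residTGslices … (nS := 0) …`), the
Gram slice carries ONE hint `(γ = 1 (code 0), v = e₁, μ = n_{0↓} as an inner monomial over Λ = {0})`, the kernel verifies that the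
move of `μ` is the raw monomial `n_{e₁↓}` of the slice's normal form and replaces it by the pushed `n_{0↓}` — after which everything
cancels (last accumulator EMPTY) — and `affineOrbitLowerRowN_of_quotChainKernelCertTB` (`Rows/CorrWindowCertKernelChainQuot.lean`)
absorbs the accepted move into the Literature theorem's licensed-move family. The instance proves only TABLE facts (`hokS`,
`hokV` by `decide`). Trust base: the Lean kernel (std axioms; no `native_decide`). No number of record; no existing claim node
discharged; CONTROL/CALIBRATION context (wording (xx1)); silent on ρ_s = 0 / presence / T_c / phase; nothing about La₂CuO₄; no summit
statement is proved by this file. Seat hubbard-obs-p2 (STIFFNESS), `prover-hubbard-obs-p2-g23-0`, zero compute.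

References: X. Han, arXiv:2006.06002 §3 [Han2020Bootstrap]; J. Wang et al., PRX 14 (2024) 031006 §III [WangEtAl2024];
C. Jansson, D. Chaykin, C. Keil, SIAM J. Numer. Anal. 46 (2008) 180 [JanssonChaykinKeil2008].
-/

namespace Summit.Ventures.CertifiedManyBodySolver

namespace CARPolyWindow

namespace Toy3x3

open Summit.Ventures.CertifiedQuantumChemistry Summit.Ventures.CertifiedQuantumChemistry.CARPoly
open Literature.MathematicalPhysics.QuantumLattice Literature.MathematicalPhysics.QuantumLattice.HubbardWave0
open Literature.MathematicalPhysics.QuantumManyBody.StateRelaxation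
open Literature.Probability.LatticeModels ThermodynamicLimit Filter Topology
open Matrix
open scoped ComplexOrder BigOperators

/-! ## The certificate data (`↓` twin of `…_bondRow`: letters index `0` = origin, `1` = `e₁`; spin `1 = ↓`) -/

/-- The objective: the `↓`-spin bond word `c†_{0↓} c_{e₁↓} + c†_{e₁↓} c_{0↓}`. [folklore] -/
def TXq : Terms (Orb (Fin 9)) :=
  [([(orb 0 1, true), (orb 1 1, false)], 1), ([(orb 1 1, true), (orb 0 1, false)], 1)]

/-- ONE two-level Gram block with ONE basis polynomial `v = a_{0↓} + a_{e₁↓}`, factor row `[1]`, `K = 0` (so the block is `v† v`).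
[cite: Han2020Bootstrap, §2 eq. (2)] -/
def blocksq : List (List (List ℤ × Terms (Orb (Fin 9)))) := [[([1], [([(orb 0 1, false)], 1), ([(orb 1 1, false)], 1)])]]

/-- The density multipliers `μ_↑ = 0`, `μ_↓ = −2`. [folklore] -/
def muq (σ : Fin 2) : ℚ := if σ = 1 then -2 else 0

/-- The geometry tables: outer window `W` (9 sites, `xs`/`ix` of `…_pauliRow`), inner window `Λ = {0}` (one site), push
`(0, σ) ↦ (0, σ)`, and ONE licensed move: code `0` (`γ = 1`) with shift `e₁ = (1, 0)`. [folklore] -/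
def Dq : QuotData 9 1 where
  xs := xs
  ix := ix
  xsβ := fun _ => 0
  f := fun b => orb 0 (ofLex b).2
  ok := fun γc v => decide (γc = 0 ∧ v = ((1 : ℤ), (0 : ℤ)))

/-- The inner letter map of `Λ = {0}`. [folklore] -/
def dΛq (b : Orb (Fin 1)) : Orb (PolySite ({0} : Finset (Site 2))) := orb (PolySite.pt 0 (Finset.mem_singleton_self 0)) (ofLex b).2

/-- The sliced residual WITHOUT symmetry slices (head; one Gram slice; charged; anti-Hermitian), regrouped `[1, 1 | rest]` into 3
chain slices. [cite: WangEtAl2024, §III] -/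
def toyQSlices : List (Terms (Orb (Fin 9))) :=
  groupSlices (residTGslices TXq muq 0 (fun σ => orb (ix 0) σ) 0 0 0 0 TE (gramTBslices 0 blocksq) TH Dq.f []
    (fun l : Fin 0 => l.elim0) (fun l : Fin 0 => l.elim0) [] []) [1, 1]

/-- The hint lists: ONE hint on the Gram slice (step 2): «`n_{e₁↓}` is `n_{0↓}` moved by `(γ = 1, v = e₁)`». Untrusted — the kernel
checks it. [cite: Han2020Bootstrap, §3] -/
def toyQHints : List (List (QHint 1)) := [[], [⟨0, (1, 0), ([orb 0 1], [orb 0 1])⟩], []]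

/-! ## The accumulators (elaboration-time literals) and the per-step KERNEL facts -/

/-- Accumulator after step 1 (head slice): `eval%` literal. [folklore] -/
def toyQC1 : SOSDual.EncPoly := eval% stepEQ Dq 32 ([] : SOSDual.EncPoly) (toyQSlices.getD 0 []) (toyQHints.getD 0 [])

/-- Accumulator after step 2 (the Gram slice, quotiented by the accepted hint): `eval%` literal. [folklore] -/
def toyQC2 : SOSDual.EncPoly := eval% stepEQ Dq 32 toyQC1 (toyQSlices.getD 1 []) (toyQHints.getD 1 [])

/-- Accumulator after step 3 (empty tail): `eval%` literal. [folklore] -/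
def toyQC3 : SOSDual.EncPoly := eval% stepEQ Dq 32 toyQC2 (toyQSlices.getD 2 []) (toyQHints.getD 2 [])

/-- The accumulator list. [folklore] -/
def toyQCs : List SOSDual.EncPoly := [[], toyQC1, toyQC2, toyQC3]

/-- KERNEL FACT, step 1 of 3. [folklore] -/
theorem toyQ_step_0 : toyQCs.getD (0 + 1) [] = stepEQ Dq 32 (toyQCs.getD 0 []) (toyQSlices.getD 0 []) (toyQHints.getD 0 []) :=
  eq_of_beq (by decide +kernel)

/-- KERNEL FACT, step 2 of 3 (the hint is checked and applied here). [folklore] -/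
theorem toyQ_step_1 : toyQCs.getD (1 + 1) [] = stepEQ Dq 32 (toyQCs.getD 1 []) (toyQSlices.getD 1 []) (toyQHints.getD 1 []) :=
  eq_of_beq (by decide +kernel)

/-- KERNEL FACT, step 3 of 3. [folklore] -/
theorem toyQ_step_2 : toyQCs.getD (2 + 1) [] = stepEQ Dq 32 (toyQCs.getD 2 []) (toyQSlices.getD 2 []) (toyQHints.getD 2 []) :=
  eq_of_beq (by decide +kernel)

/-- **The hinted chain record**, assembled by pattern matching on `Fin 3`. [cite: JanssonChaykinKeil2008, §3] -/
theorem toyQ_chain_ok : ChainQOK Dq 32 3 toyQCs toyQSlices toyQHints where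
  len := by decide +kernel
  step i := match i with
    | ⟨0, _⟩ => toyQ_step_0
    | ⟨1, _⟩ => toyQ_step_1
    | ⟨2, _⟩ => toyQ_step_2
    | ⟨n + 3, h⟩ => absurd h (by omega)

/-- The hint WAS accepted: the last accumulator is the EMPTY polynomial. Decided by the kernel. [folklore] -/
theorem toyQ_last_nil : toyQCs.getD 3 [] = [] := by decide +kernel

/-- **The ONE rational inequality on the last accumulator**: `−7/8 ≤ lowerConst (decPoly 9 C₃) + (μ_↑ + μ_↓)(n₀/2 − ν)`.
[cite: WangEtAl2024, §III] -/
theorem toyQ_lowerConst :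
    (-7 / 8 : ℚ) ≤ lowerConst (SOSDual.decPoly 9 (toyQCs.getD 3 [])) + (muq 0 + muq 1) * ((7 / 8 : ℚ) / 2 - 0) := by
  decide +kernel

/-! ## The end-to-end theorem -/

/-- Membership-proof irrelevance for ordered sites. [folklore] -/
private theorem pt_congr_site₆ {V : Finset (Site 2)} {x y : Site 2} (hx : x ∈ V) (hy : y ∈ V) (h : x = y) :
    PolySite.pt x hx = PolySite.pt y hy := by
  subst h; rfl

/-- **STEP-0, hinted-quotient edition: the affine-N claim-node predicate for the `↓` bond word at `(1, −3/10, 29/5)`, value `−7/8`,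
slope `−1` at `n₀ = 7/8`, orbit set `{1}`, from the 3-step HINTED chain — ZERO hypotheses, no symmetry data.** [cite: WangEtAl2024, §III]
[cite: Han2020Bootstrap, §3] -/
theorem toyQ_affineOrbitLowerRowN :
    SquareTTPrimeCorrAffineOrbitLowerRowN (((-3 / 10 : ℚ)) : ℝ) (((29 / 5 : ℚ)) : ℝ) (-7 / 8) 0 0 0 0 (-1) (7 / 8) {1} W
      (termOp d TXq) := by
  have hz : (0 : Site 2) ∈ W := zero_mem_thicken_zero 1
  have h1 : (1 : DihedralGroup 4) ∈ ({1} : Finset (DihedralGroup 4)) := Finset.mem_singleton_self 1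
  have hmul : ∀ a ∈ ({1} : Finset (DihedralGroup 4)), ∀ b ∈ ({1} : Finset (DihedralGroup 4)),
      a * b ∈ ({1} : Finset (DihedralGroup 4)) := by
    intro a ha b hb
    rw [Finset.mem_singleton] at ha hb ⊢
    rw [ha, hb, mul_one]
  have hΛ : ({0} : Finset (Site 2)) ⊆ W := Finset.singleton_subset_iff.2 hz
  have hx0 : xs 0 = 0 := xs_zero
  have hix0 : xs (ix 0) = 0 := xs_ix_of_mem 0 hz
  have ho : ∀ σ : Fin 2, d (orb (ix 0) σ) = orb (PolySite.pt 0 hz) σ := by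
    intro σ
    rw [d_orb, pt_congr_site₆ (xs_mem (ix 0)) hz hix0]
  have hxsβ : ∀ j : Fin 1, Dq.xsβ j ∈ ({0} : Finset (Site 2)) := fun _ => Finset.mem_singleton_self 0
  have hcovβ : ∀ x ∈ ({0} : Finset (Site 2)), ∃ j : Fin 1, Dq.xsβ j = x := by
    intro x hx
    rw [Finset.mem_singleton] at hx
    exact ⟨0, hx.symm⟩
  have hdΛ : ∀ (j : Fin 1) (σ : Fin 2), dΛq (orb j σ) = orb (PolySite.pt (Dq.xsβ j) (hxsβ j)) σ := fun _ _ => rfl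
  have hf : ∀ b : Orb (Fin 1), d (Dq.f b) = Orb.embMap (PolySite.incl hΛ) (dΛq b) := by
    intro b
    show d (orb 0 (ofLex b).2) = _
    rw [d_orb, pt_congr_site₆ (xs_mem 0) (hΛ (Finset.mem_singleton_self 0)) hx0]
    rfl
  have hokS : ∀ (γc : Fin 8) (v : ℤ × ℤ), Dq.ok γc v = true → d4OfCode γc ∈ ({1} : Finset (DihedralGroup 4)) := by
    intro γc v h
    have h' : γc = 0 ∧ v = ((1 : ℤ), (0 : ℤ)) := of_decide_eq_true h
    rw [h'.1]
    exact h1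
  have hokV : ∀ (γc : Fin 8) (v : ℤ × ℤ), Dq.ok γc v = true → ∀ j : Fin 1,
      Dq.xs (Dq.ix (d4Vec (d4OfCode γc) (Dq.xsβ j) + siteOfPair v)) = d4Vec (d4OfCode γc) (Dq.xsβ j) + siteOfPair v := by
    intro γc v h j
    have h' : γc = 0 ∧ v = ((1 : ℤ), (0 : ℤ)) := of_decide_eq_true h
    obtain ⟨rfl, rfl⟩ := h'
    revert j
    decide
  have hH : termOp d TH = (hubbardTTPrimeFermionInteraction 1 (((-3 / 10 : ℚ)) : ℝ) (((29 / 5 : ℚ)) : ℝ)).localHamiltonian W := by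
    rw [TH, termOp_hamTermsIdx 1 (-3 / 10) (29 / 5) xs xs_mem xs_injective xs_cover d d_orb, Rat.cast_one]
  have hE : termOp d TE = fermionEmbed (PolySite.incl (subset_refl W))
      ((hubbardTTPrimeFermionInteraction 1 (((-3 / 10 : ℚ)) : ℝ) (((29 / 5 : ℚ)) : ℝ)).meanEnergyObs 1) := by
    rw [TE, termOp_energyTermsIdx 1 (-3 / 10) (29 / 5) xs xs_mem (subset_refl W) ix xs_ix_of_mem d d_orb, Rat.cast_one]
  exact affineOrbitLowerRowN_of_quotChainKernelCertTB (-3 / 10) (29 / 5) (by norm_num) hΛ (subset_refl W) (subset_refl W) hz h1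
    hmul Dq xs_mem xs_ix_of_mem hxsβ hcovβ d d_injective d_orb 32 dΛq hdΛ hf (fun p => (ofLex p).2) (fun _ => rfl) hokS hokV
    TH hH TE hE (fun σ => orb (ix 0) σ) ho TXq muq 0 0 0 0 0 0 blocksq [] [] (fun wc hwc => absurd hwc List.not_mem_nil) []
    [1, 1] 3 toyQCs rfl toyQHints toyQ_chain_ok (by norm_num [muq]) toyQ_lowerConst

end Toy3x3

end CARPolyWindow

end Summit.Ventures.CertifiedManyBodySolver
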